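import Summits.ABC.StewartYu.PadicG3TwoBudgetZN
import Summits.ABC.StewartYu.PadicG3TwoSatSupplyW
import HarnessLib

/-!
# Cell abc-stewartyu, WP-L.P(2) (crux r4 `PadicCoreTwoRat`, stmt-ABC-20504), record: the slots of the schedule of record `schedTwoN` in the
# BUDGET UNIT `Z = G·X·L`, II — the directional line at the padded letter and the virtual far heights

`Summits/ABC/StewartYu/PadicG3TwoBudgetZBN.lean` — cell `abc-stewartyu`, route `YuMatveevShapeRat`, seat p3 (g10; memo-13 §1 + STATUS
20:34Z v3).  Theorems only; sequel of `PadicG3TwoBudgetZN`: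
* **`log_Xb3N_le_pad`** (`log Xb3N ≤ 3·W_L` when the coefficients are bounded at `W₀` with `W₀ + c_W(d) ≤ P.W` — the padding `c_W(d) =
  (2d+5)(d+1)` of `PadicG3TwoSatSupplyW` absorbs the Hermite factor `((d+1)!)²` of the `ϑ`-box), **`mul_log_Xb3N_le_Z`** (`T·log Xb3N ≤ (21/32)·Z`
  for `T ≤ T03N 0`);
* far heights: `box_unit_le`, **`far0_le_Z`** (`4|x₁|·hboxvN 0 ≤ (25/16)·3^k·Z` at `|x₁| ≤ Nsub3N 0 (k+1)`), **`farI_le_Z`** (`≤ (25/8)·3^k·Z`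
  at `I ≥ 1`), `siegel_far_le_Z` (`4X·hboxvN 0 ≤ (17/32)·Z`), `sum_Vo_le_Z` (`8ΣA ≤ Z/2^15`).

WHAT THIS IS NOT: the budget comparisons (sequel `PadicG3TwoBudgetKN/TN`); no crux moves.

References: Yu. V. Nesterenko, LNM 1819 (2003), §4.2 (4.19)–(4.35); K. Yu, Acta Math. 211 (2013), §3.1, Lemma 5.2.
-/
noncomputable section

open Finset Real
open scoped Nat
open Literature.NumberTheory.Transcendental
open Literature.NumberTheory.Transcendental.CW77.Setup (Tau tauNorm)

namespace Summit.ABC.StewartYu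

namespace TwoSetup

open Summit.ABC.StewartYu.G3Boxes Summit.ABC.StewartYu.PadicG3Par

variable (S : TwoSetup) (F : S.SatData) (P : PadicG3Par (S.d + 1))

/-! ### The directional line at the padded letter -/

set_option maxHeartbeats 400000 in
/-- **`log Xb3N I ≤ 3·W_L`** when the coefficients are bounded at a letter `W₀` with `W₀ + c_W(d) ≤ P.W` (the padding absorbs the Hermite
factors: `(2d+5)·log(d+1) ≤ c_W(d)`). [cite: Nesterenko2003, §4.2 (4.26); shape only] -/
theorem log_Xb3N_le_pad (hA1 : ∀ j, 1 ≤ P.A j) (hN : (F.N : ℝ) ≤ (2 / Real.log 2) ^ (S.d + 1) * P.Ω) {W₀ : ℝ}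
    (hball : ∀ k, (|S.ball k| : ℝ) ≤ (((S.d + 1) * (S.d + 1)! : ℕ) : ℝ) * F.N * Real.exp W₀)
    (hpad : W₀ + (cW S.d : ℝ) ≤ P.W) (I : ℕ) :
    Real.log (S.Xb3N F P I : ℝ) ≤ 3 * P.WL := by
  have hXpos : (0 : ℝ) < (S.Xb3N F P I : ℝ) := by
    exact_mod_cast (show (0 : ℤ) < S.Xb3N F P I by have := S.one_le_Xb3N F P I; omega)
  have hNL := S.N_le_L F P hN
  have hN0 : (0 : ℝ) < F.N := by exact_mod_cast F.hN
  have hD := S.Dco_real_le F P hA1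
  have hL0 : (0 : ℝ) < P.L := by linarith [P.one_le_L]
  have hd1 : (1 : ℝ) ≤ (S.d : ℝ) + 1 := by
    have h0 : (0 : ℝ) ≤ S.d := Nat.cast_nonneg _
    linarith
  have hW := S.exp_W_mul_L_le P
  set Bb : ℝ := (((S.d + 1) * (S.d + 1)! : ℕ) : ℝ) * F.N * Real.exp W₀ with hBb
  have hsumb : (|(S.bθ : ℝ)| + ∑ j, |(S.b j : ℝ)|) ≤ ((S.d : ℝ) + 1) * Bb := by
    have hθ : (|(S.bθ : ℝ)|) ≤ Bb := by have := hball (Fin.last S.d); unfold ball at this; simpa using this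
    have hj : ∀ j, (|(S.b j : ℝ)|) ≤ Bb := by
      intro j; have := hball (Fin.castSucc j); unfold ball at this; simpa using this
    calc (|(S.bθ : ℝ)| + ∑ j, |(S.b j : ℝ)|) ≤ Bb + ∑ _j : Fin S.d, Bb := add_le_add hθ (Finset.sum_le_sum fun j _ => hj j)
      _ = ((S.d : ℝ) + 1) * Bb := by rw [Finset.sum_const, Finset.card_univ, Fintype.card_fin, nsmul_eq_mul]; ring
  have hDcoR : (S.DcoR F P I : ℝ) ≤ S.Dco F P := by
    have : S.DcoR F P I ≤ S.Dco F P := by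
      unfold DcoR; split_ifs with hI
      · exact le_rfl
      · have h3 : 3 ≤ 3 ^ I := by
          calc 3 = 3 ^ 1 := by norm_num
            _ ≤ 3 ^ I := Nat.pow_le_pow_right (by norm_num) (by omega)
        calc 2 * S.Dco F P / 3 ^ I ≤ 2 * S.Dco F P / 3 := Nat.div_le_div_left h3 (by norm_num)
          _ ≤ S.Dco F P := by omega
    exact_mod_cast this
  have hX : (S.Xb3N F P I : ℝ) ≤ 1 + ((S.d : ℝ) + 1) * Bb * S.Dco F P := by
    unfold Xb3N; push_cast
    have h0 : (0 : ℝ) ≤ (S.DcoR F P I : ℝ) := by positivity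
    have hB0 : 0 ≤ Bb := by positivity
    nlinarith [mul_le_mul hsumb hDcoR h0 (by positivity)]
  have hfact : (((S.d + 1)! : ℕ) : ℝ) ≤ ((S.d : ℝ) + 1) ^ (S.d + 1) := by
    have := Nat.factorial_le_pow (S.d + 1); exact_mod_cast this
  set D1 : ℝ := ((S.d : ℝ) + 1) with hD1
  -- `e^{W₀}·L ≤ e^{W_L}·e^{W₀ − W}/(2e)`
  have hW0 : Real.exp W₀ * P.L ≤ Real.exp P.WL * Real.exp (W₀ - P.W) / (2 * Real.exp 1) := by
    have e : Real.exp W₀ = Real.exp P.W * Real.exp (W₀ - P.W) := by rw [← Real.exp_add]; ring_nf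
    rw [e, mul_assoc, mul_comm (Real.exp (W₀ - P.W)), ← mul_assoc]
    have := mul_le_mul_of_nonneg_right hW (Real.exp_pos (W₀ - P.W)).le
    rw [div_mul_eq_mul_div] at this
    exact this
  have hNN : (F.N : ℝ) * F.N ≤ P.L * P.L / 2 ^ 18 := by
    rw [le_div_iff₀ (by norm_num)]; nlinarith
  have hcore : (F.N * Real.exp W₀) * (F.N * P.L) ≤ (P.L : ℝ) ^ 2 * (Real.exp P.WL * Real.exp (W₀ - P.W)) := by
    have e1 : (F.N * Real.exp W₀) * (F.N * P.L) = (F.N * F.N) * (Real.exp W₀ * P.L) := by ring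
    rw [e1]
    have h1 : (F.N * F.N) * (Real.exp W₀ * P.L) ≤ (P.L * P.L / 2 ^ 18) * (Real.exp P.WL * Real.exp (W₀ - P.W) / (2 * Real.exp 1)) :=
      mul_le_mul hNN hW0 (by have := Real.exp_pos W₀; positivity) (by positivity)
    refine h1.trans ?_
    have he : (1 : ℝ) ≤ Real.exp 1 := Real.one_le_exp zero_le_one
    have hE : 0 ≤ Real.exp P.WL * Real.exp (W₀ - P.W) := by positivity
    rw [pow_two]
    have : P.L * P.L / 2 ^ 18 * (Real.exp P.WL * Real.exp (W₀ - P.W) / (2 * Real.exp 1)) =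
        (P.L * P.L * (Real.exp P.WL * Real.exp (W₀ - P.W))) / (2 ^ 18 * (2 * Real.exp 1)) := by field_simp
    rw [this]
    exact div_le_self (by positivity) (by nlinarith)
  have hprod : D1 * Bb * S.Dco F P ≤ D1 ^ (2 * S.d + 5) * ((P.L : ℝ) ^ 2 * (Real.exp P.WL * Real.exp (W₀ - P.W))) := by
    have hBb' : Bb ≤ D1 ^ (S.d + 2) * (F.N * Real.exp W₀) := by
      rw [hBb]; push_cast
      calc ((S.d : ℝ) + 1) * (((S.d + 1)! : ℕ) : ℝ) * F.N * Real.exp W₀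
          ≤ ((S.d : ℝ) + 1) * ((S.d : ℝ) + 1) ^ (S.d + 1) * F.N * Real.exp W₀ := by gcongr
        _ = D1 ^ (S.d + 2) * (F.N * Real.exp W₀) := by rw [hD1]; ring
    have hDco' : (S.Dco F P : ℝ) ≤ D1 ^ (S.d + 2) * (F.N * P.L) := by
      calc (S.Dco F P : ℝ) ≤ (((S.d + 1)! : ℕ) : ℝ) * (((S.d : ℝ) + 1) * (F.N * P.L)) := hD
        _ ≤ ((S.d : ℝ) + 1) ^ (S.d + 1) * (((S.d : ℝ) + 1) * (F.N * P.L)) := by gcongr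
        _ = D1 ^ (S.d + 2) * (F.N * P.L) := by rw [hD1]; ring
    calc D1 * Bb * S.Dco F P ≤ D1 * (D1 ^ (S.d + 2) * (F.N * Real.exp W₀)) * (D1 ^ (S.d + 2) * (F.N * P.L)) := by gcongr
      _ = D1 ^ (2 * S.d + 5) * ((F.N * Real.exp W₀) * (F.N * P.L)) := by ring
      _ ≤ D1 ^ (2 * S.d + 5) * ((P.L : ℝ) ^ 2 * (Real.exp P.WL * Real.exp (W₀ - P.W))) :=
          mul_le_mul_of_nonneg_left hcore (by positivity)
  set M : ℝ := D1 ^ (2 * S.d + 5) * ((P.L : ℝ) ^ 2 * (Real.exp P.WL * Real.exp (W₀ - P.W))) with hM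
  have hM0 : 0 < M := by positivity
  have hX2 : (S.Xb3N F P I : ℝ) ≤ 1 + M := by linarith
  have hlogM : Real.log M = (2 * (S.d : ℝ) + 5) * Real.log D1 + (2 * Real.log P.L + (P.WL + (W₀ - P.W))) := by
    rw [hM, Real.log_mul (by positivity) (by positivity), Real.log_mul (by positivity) (by positivity),
      Real.log_mul (by positivity) (by positivity), Real.log_pow, Real.log_pow, Real.log_exp, Real.log_exp]
    push_cast; ring
  have hlog2L : Real.log 2 + Real.log P.L ≤ P.WL - 2 := by
    have h := P.W_add_log_le_WL
    rw [Real.log_mul (by norm_num) hL0.ne'] at h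
    linarith [P.hW]
  have hWL1 := P.WL_ge_one
  have hlog2' : Real.log 2 ≤ 7 / 10 := log_two_le
  have hlog2pos : 0 ≤ Real.log 2 := Real.log_nonneg (by norm_num)
  -- `(2d+5) log(d+1) ≤ c_W(d) ≤ P.W − W₀`
  have hcW : (2 * (S.d : ℝ) + 5) * Real.log ((S.d : ℝ) + 1) ≤ (cW S.d : ℝ) := by
    unfold cW; push_cast
    have hlog : Real.log ((S.d : ℝ) + 1) ≤ (S.d : ℝ) + 1 - 1 := Real.log_le_sub_one_of_pos (by positivity)
    have h0 : (0 : ℝ) ≤ S.d := Nat.cast_nonneg _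
    have hl0 : 0 ≤ Real.log ((S.d : ℝ) + 1) := Real.log_nonneg hd1
    nlinarith
  rcases le_or_gt M 1 with hM1 | hM1
  · have : Real.log (S.Xb3N F P I : ℝ) ≤ Real.log 2 := Real.log_le_log hXpos (by linarith)
    linarith
  · have h1 : Real.log (S.Xb3N F P I : ℝ) ≤ Real.log (2 * M) := Real.log_le_log hXpos (by linarith)
    rw [Real.log_mul (by norm_num) hM0.ne', hlogM, hD1] at h1
    linarith

/-- **`T·log Xb3N I ≤ (21/32)·Z`** for `T ≤ T03N 0`, at the padded letter. [cite: Nesterenko2003, §4.2 (4.23); shape only] -/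
theorem mul_log_Xb3N_le_Z (hNq : P.Nq = 2 ^ (P.m + 2)) (hA1 : ∀ j, 1 ≤ P.A j)
    (hN : (F.N : ℝ) ≤ (2 / Real.log 2) ^ (S.d + 1) * P.Ω) {W₀ : ℝ}
    (hball : ∀ k, (|S.ball k| : ℝ) ≤ (((S.d + 1) * (S.d + 1)! : ℕ) : ℝ) * F.N * Real.exp W₀)
    (hpad : W₀ + (cW S.d : ℝ) ≤ P.W) (I : ℕ) {T : ℝ} (hT : T ≤ S.T03N F P 0) :
    T * Real.log (S.Xb3N F P I : ℝ) ≤ (21 / 32) * (P.G * P.X * P.L) := by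
  set Z : ℝ := P.G * P.X * P.L with hZ
  set N1 : ℝ := (S.d : ℝ) + 1 + 1 with hN1
  have hd0 : (0 : ℝ) ≤ (S.d : ℝ) := by positivity
  have hXb := S.log_Xb3N_le_pad F P hA1 hN hball hpad I
  have hXb0 : 0 ≤ Real.log (S.Xb3N F P I : ℝ) := Real.log_nonneg (by exact_mod_cast S.one_le_Xb3N F P I)
  have hres := S.reserve_le_L F P hNq (S.N_le_L_nat F P hN)
  have hTT := S.T03N_zero_le F P hres
  have hWL := P.WL_mul_le; push_cast at hWL
  have hWL1 := P.WL_ge_one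
  have hL0 : (0 : ℝ) ≤ P.L := by positivity
  have hT' : T ≤ (8 * N1 + 12) * P.L := by rw [hN1]; linarith
  -- `T·log Xb ≤ (8N1+12)L·3W_L ≤ 3(8N1+12)·Z/(64 N1) ≤ (21/32)Z` (`N1 ≥ 2`)
  have h1 : T * Real.log (S.Xb3N F P I : ℝ) ≤ (8 * N1 + 12) * P.L * (3 * P.WL) := by
    rcases le_or_gt 0 T with hT0 | hT0
    · exact mul_le_mul hT' hXb hXb0 (by positivity)
    · have : T * Real.log (S.Xb3N F P I : ℝ) ≤ 0 := mul_nonpos_of_nonpos_of_nonneg hT0.le hXb0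
      have : 0 ≤ (8 * N1 + 12) * P.L * (3 * P.WL) := by positivity
      linarith
  have h2 : N1 * P.L * P.WL ≤ Z / 64 := by rw [hN1, hZ]; linarith
  have hN1' : 2 ≤ N1 := by rw [hN1]; linarith
  have h3 : (8 * N1 + 12) * P.L * (3 * P.WL) ≤ 14 * N1 * (P.L * (3 * P.WL)) := by
    have : 8 * N1 + 12 ≤ 14 * N1 := by linarith
    have h0 : 0 ≤ P.L * (3 * P.WL) := by positivity
    nlinarith
  nlinarith

/-! ### The virtual far heights -/

/-- `2ΣA ≤ (d+1)·L/2^9`, so `(d+1)L + 2ΣA ≤ (1 + 2^{-9})·(d+1)·L`. [folklore] -/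
theorem box_unit_le (hA1 : ∀ j, 1 ≤ P.A j) :
    ((S.d : ℝ) + 1) * P.L + 2 * ∑ j, P.A j ≤ (1 + 1 / 2 ^ 9) * (((S.d : ℝ) + 1) * P.L) := by
  have h := S.sum_A_le P hA1
  nlinarith

/-- **Level-`0` far height**: `4|x₁|·hboxvN (2A) 0 ≤ (25/16)·3^k·Z` for `|x₁| ≤ Nsub3N 0 (k+1)`. [cite: Nesterenko2003, (4.35); shape only] -/
theorem far0_le_Z (hA1 : ∀ j, 1 ≤ P.A j) {k : ℕ} {x₁ : ℤ} (hx : |x₁| ≤ (S.Nsub3N P 0 (k + 1) : ℤ)) :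
    4 * |(x₁ : ℝ)| * S.hboxvN F P (fun j => 2 * P.A j) 0 ≤ (25 / 16) * (3 : ℝ) ^ k * (P.G * P.X * P.L) := by
  obtain ⟨hX36, hG8, hL25, hLG, hLL, hLH, hXL⟩ := S.base_facts P
  have hh := S.hboxvN_zero_le F P
  have hu := S.box_unit_le P hA1
  have hh0 : 0 ≤ S.hboxvN F P (fun j => 2 * P.A j) 0 := S.hboxvN_nonneg F P (fun j => by have := P.A_pos j; positivity) 0
  -- `|x₁| ≤ 3^{k+1}·Xs3N 0 ≤ 3^{k+1}·X`
  have hNs : S.Nsub3N P 0 (k + 1) = 3 ^ (k + 1) * S.Xs3N P 0 := by unfold Nsub3N; rw [if_neg (by omega)]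
  have hx' : |(x₁ : ℝ)| ≤ (3 : ℝ) ^ (k + 1) * P.X := by
    have h1 : |(x₁ : ℝ)| ≤ ((3 ^ (k + 1) * S.Xs3N P 0 : ℕ) : ℝ) := by rw [← hNs]; exact_mod_cast hx
    push_cast at h1
    have h2 := S.Xs3N_zero_le P
    nlinarith [pow_pos (show (0:ℝ) < 3 by norm_num) (k + 1)]
  set N1 : ℝ := (S.d : ℝ) + 1 + 1 with hN1
  have hd0 : (0 : ℝ) ≤ (S.d : ℝ) := by positivity
  have h3k : (0 : ℝ) < (3 : ℝ) ^ k := by positivity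
  -- `4·3^{k+1}X·(1+2^{-9})(d+1)L = 12(1+2^{-9})·3^k·(d+1)·X·L ≤ (12(1+2^{-9})/8)·3^k·Z`
  have hXL' : ((S.d : ℝ) + 1) * (P.X * P.L) ≤ (P.G * P.X * P.L) / 8 := by
    have : ((S.d : ℝ) + 1) ≤ N1 := by rw [hN1]; linarith
    have h0 : 0 ≤ P.X * (P.L : ℝ) := by positivity
    nlinarith
  calc 4 * |(x₁ : ℝ)| * S.hboxvN F P (fun j => 2 * P.A j) 0
      ≤ 4 * ((3 : ℝ) ^ (k + 1) * P.X) * ((1 + 1 / 2 ^ 9) * (((S.d : ℝ) + 1) * P.L)) := by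
        gcongr
        exact hh.trans hu
    _ = 12 * (1 + 1 / 2 ^ 9) * (3 : ℝ) ^ k * (((S.d : ℝ) + 1) * (P.X * P.L)) := by rw [pow_succ]; ring
    _ ≤ 12 * (1 + 1 / 2 ^ 9) * (3 : ℝ) ^ k * ((P.G * P.X * P.L) / 8) := by gcongr
    _ ≤ (25 / 16) * (3 : ℝ) ^ k * (P.G * P.X * P.L) := by
        have hZ0 : 0 ≤ P.G * P.X * P.L := by have := P.GXL_ge; linarith [show (0:ℝ) ≤ 16*72*2^25 by positivity]
        nlinarith

/-- **Deep far height**: `4|x₁|·hboxvN (2A) I ≤ (25/8)·3^k·Z` for `I ≥ 1`, `|x₁| ≤ Nsub3N I (k+1)`. [cite: Nesterenko2003, (4.35); shape only] -/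
theorem farI_le_Z (hA1 : ∀ j, 1 ≤ P.A j) {I : ℕ} (hI : 1 ≤ I) {k : ℕ} {x₁ : ℤ} (hx : |x₁| ≤ (S.Nsub3N P I (k + 1) : ℤ)) :
    4 * |(x₁ : ℝ)| * S.hboxvN F P (fun j => 2 * P.A j) I ≤ (25 / 8) * (3 : ℝ) ^ k * (P.G * P.X * P.L) := by
  obtain ⟨hX36, hG8, hL25, hLG, hLL, hLH, hXL⟩ := S.base_facts P
  have hh := S.hboxvN_le_of_pos F P hI
  have hu := S.box_unit_le P hA1
  have h3I : (0 : ℝ) < (3 : ℝ) ^ I := by positivity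
  have hNs : S.Nsub3N P I (k + 1) = 3 ^ (k + 1) * S.Xs3N P I := by unfold Nsub3N; rw [if_neg (by omega)]
  have hx' : |(x₁ : ℝ)| ≤ (3 : ℝ) ^ (k + 1) * ((3 : ℝ) ^ I * P.X) := by
    have h1 : |(x₁ : ℝ)| ≤ ((3 ^ (k + 1) * S.Xs3N P I : ℕ) : ℝ) := by rw [← hNs]; exact_mod_cast hx
    push_cast at h1
    have h2 := (S.Xs3N_lt P I).le
    nlinarith [pow_pos (show (0:ℝ) < 3 by norm_num) (k + 1)]
  set N1 : ℝ := (S.d : ℝ) + 1 + 1 with hN1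
  have hd0 : (0 : ℝ) ≤ (S.d : ℝ) := by positivity
  have hXL' : ((S.d : ℝ) + 1) * (P.X * P.L) ≤ (P.G * P.X * P.L) / 8 := by
    have : ((S.d : ℝ) + 1) ≤ N1 := by rw [hN1]; linarith
    have h0 : 0 ≤ P.X * (P.L : ℝ) := by positivity
    nlinarith
  have hbox0 : 0 ≤ (1 + 1 / 2 ^ 9) * (((S.d : ℝ) + 1) * (P.L : ℝ)) := by positivity
  calc 4 * |(x₁ : ℝ)| * S.hboxvN F P (fun j => 2 * P.A j) I
      ≤ 4 * ((3 : ℝ) ^ (k + 1) * ((3 : ℝ) ^ I * P.X)) * (2 / (3 : ℝ) ^ I * ((1 + 1 / 2 ^ 9) * (((S.d : ℝ) + 1) * P.L))) := by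
        gcongr
        · exact S.hboxvN_nonneg F P (fun j => by have := P.A_pos j; positivity) I
        · exact hh.trans (mul_le_mul_of_nonneg_left hu (by positivity))
    _ = 24 * (1 + 1 / 2 ^ 9) * (3 : ℝ) ^ k * (((S.d : ℝ) + 1) * (P.X * P.L)) := by
        field_simp; rw [pow_succ]; ring
    _ ≤ 24 * (1 + 1 / 2 ^ 9) * (3 : ℝ) ^ k * ((P.G * P.X * P.L) / 8) := by gcongr
    _ ≤ (25 / 8) * (3 : ℝ) ^ k * (P.G * P.X * P.L) := by
        have hZ0 : 0 ≤ P.G * P.X * P.L := by have := P.GXL_ge; linarith [show (0:ℝ) ≤ 16*72*2^25 by positivity]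
        have h3k : (0 : ℝ) < (3 : ℝ) ^ k := by positivity
        nlinarith

/-- **The level-`0` Siegel far height**: `4X·hboxvN (2A) 0 ≤ (17/32)·Z`. [cite: Yu2013, (4.28); shape only] -/
theorem siegel_far_le_Z (hA1 : ∀ j, 1 ≤ P.A j) :
    4 * (P.X : ℝ) * S.hboxvN F P (fun j => 2 * P.A j) 0 ≤ (17 / 32) * (P.G * P.X * P.L) := by
  obtain ⟨hX36, hG8, hL25, hLG, hLL, hLH, hXL⟩ := S.base_facts P
  have hh := (S.hboxvN_zero_le F P).trans (S.box_unit_le P hA1)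
  set N1 : ℝ := (S.d : ℝ) + 1 + 1 with hN1
  have hd0 : (0 : ℝ) ≤ (S.d : ℝ) := by positivity
  have hX0 : (0 : ℝ) ≤ P.X := by positivity
  have hXL' : ((S.d : ℝ) + 1) * (P.X * P.L) ≤ (P.G * P.X * P.L) / 8 := by
    have : ((S.d : ℝ) + 1) ≤ N1 := by rw [hN1]; linarith
    have h0 : 0 ≤ P.X * (P.L : ℝ) := by positivity
    nlinarith
  calc 4 * (P.X : ℝ) * S.hboxvN F P (fun j => 2 * P.A j) 0 ≤ 4 * (P.X : ℝ) * ((1 + 1 / 2 ^ 9) * (((S.d : ℝ) + 1) * P.L)) :=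
        mul_le_mul_of_nonneg_left hh (by positivity)
    _ = 4 * (1 + 1 / 2 ^ 9) * (((S.d : ℝ) + 1) * (P.X * P.L)) := by ring
    _ ≤ 4 * (1 + 1 / 2 ^ 9) * ((P.G * P.X * P.L) / 8) := by gcongr
    _ ≤ (17 / 32) * (P.G * P.X * P.L) := by
        have hZ0 : 0 ≤ P.G * P.X * P.L := by have := P.GXL_ge; linarith [show (0:ℝ) ≤ 16*72*2^25 by positivity]
        nlinarith

/-- The additive slop of the virtual denominators: `8·ΣA ≤ Z/2^15`. [folklore] -/
theorem sum_Vo_le_Z (hA1 : ∀ j, 1 ≤ P.A j) : 4 * ∑ j, 2 * P.A j ≤ (P.G * P.X * P.L) / 2 ^ 15 := by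
  obtain ⟨hX36, hG8, hL25, hLG, hLL, hLH, hXL⟩ := S.base_facts P
  have h := S.sum_A_le P hA1
  rw [← Finset.mul_sum]
  set N1 : ℝ := (S.d : ℝ) + 1 + 1 with hN1
  have hd0 : (0 : ℝ) ≤ (S.d : ℝ) := by positivity
  -- `8ΣA ≤ 8(d+1)L/2^10 ≤ N1·L/128 ≤ Z/(288·128·N1)·N1…`; crude: `288 N1² L ≤ Z`, `N1 ≥ 2`
  have hN1' : 2 ≤ N1 := by rw [hN1]; linarith
  have hL0 : (0 : ℝ) ≤ P.L := by positivity
  rw [le_div_iff₀ (by positivity)]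
  -- `8ΣA·2^15 ≤ 256(d+1)L ≤ 288 N1² L ≤ Z`
  have h1 : 4 * (2 * ∑ i, P.A i) * 2 ^ 15 ≤ 256 * (((S.d : ℝ) + 1) * P.L) := by nlinarith
  have h2 : 256 * (((S.d : ℝ) + 1) * P.L) ≤ 288 * N1 ^ 2 * P.L := by
    have hsq : ((S.d : ℝ) + 1) ≤ N1 ^ 2 := by rw [hN1]; nlinarith
    nlinarith [mul_le_mul_of_nonneg_right hsq hL0]
  linarith

end TwoSetup

end Summit.ABC.StewartYu

end
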